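import Mathlib.Analysis.Calculus.ContDiff.Operations
import Mathlib.Analysis.Calculus.Deriv.Comp
import Mathlib.MeasureTheory.Integral.IntervalIntegral.FundThmCalculus
import HarnessLib

/-!
# Joint `C¹` regularity on the closed half-space from the kinetic structure

Analysis/Calculus support file (everything proved, theorems only). The classical observation by
which a *mild* solution of a kinetic equation with continuous data is a *classical* one up to the
initial time (e.g. Cercignani–Illner–Pulvirenti 1994, §5.3 Lemma 5.3.6: the solutions of the
truncated problems are `C¹(ℝ₊; 𝒮)`; Glassey, *The Cauchy Problem in Kinetic Theory* (1996),
§1.1): let `F : ℝ → (E × E) → G`, `(t, (x, v)) ↦ F t (x, v)`, be such that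

* every slice `F t`, `t ≥ 0`, is Fréchet differentiable, with derivative `D t z` jointly
  continuous in `(t, z)` on `[0, ∞) × (E × E)`;
* along every free-transport characteristic `σ ↦ (σ, x₀ + σ v, v)`, `σ ≥ 0`, `F` has the
  (right, at `σ = 0`) derivative `ψ σ (x₀ + σ v, v)`, with `ψ` jointly continuous on
  `[0, ∞) × (E × E)`.

Then `(t, z) ↦ F t z` is Fréchet differentiable *within the closed half-space*
`[0, ∞) × (E × E)` at every point, with derivative
`(τ, h) ↦ τ (ψ t z - D t z (v, 0)) + D t z h` (`hasFDerivWithinAt_kinetic`); consequently it is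
`C¹` there in the sense of `ContDiffOn` (`contDiffOn_one_kinetic`), its one-sided time derivative
is `∂ₜF = ψ - D (v, 0)` (`derivWithin_kinetic`), i.e. `∂ₜF + v·∇ₓF = ψ`
(`derivWithin_add_fderiv_kinetic`). The proof is the mean value / fundamental-theorem argument of
"continuous partial derivatives imply `C¹`" (Dieudonné (8.9.1)) with the time direction replaced
by the characteristic direction, along which only a right derivative is required (Mathlib's
`intervalIntegral.integral_eq_sub_of_hasDeriv_right_of_le`).

## Mathlib search

`HasFDerivAt.of_partial`-type statements: the tree's
`Literature.Analysis.Calculus.JointSmoothnessPartials` (`hasFDerivAt_of_partial`, open sets,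
coordinate directions); Mathlib: `hasFDerivWithinAt_closure_of_tendsto_fderiv` (extension to the
boundary, needs differentiability on the open side first). Neither covers one-sided derivatives
along a non-coordinate (velocity dependent) direction.

## References

* C. Cercignani, R. Illner, M. Pulvirenti, *The Mathematical Theory of Dilute Gases* (1994),
  §5.3 Lemma 5.3.6.
* R. T. Glassey, *The Cauchy Problem in Kinetic Theory*, SIAM (1996), §1.1.
* J. Dieudonné, *Foundations of Modern Analysis* (1960), (8.9.1).
-/

noncomputable section

open Set Filter Function Metric Topology intervalIntegral
open scoped ContDiff

namespace Literature.Analysis.Calculus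

variable {E : Type*} [NormedAddCommGroup E] [NormedSpace ℝ E]
variable {G : Type*} [NormedAddCommGroup G] [NormedSpace ℝ G] [CompleteSpace G]

/-- **The fundamental theorem of calculus along characteristics** with right derivatives: if
`σ ↦ F σ (x₀ + σ v, v)` has right derivative `ψ σ (x₀ + σ v, v)` within `[0, ∞)` at every `σ ≥ 0`
and `ψ` is jointly continuous on `[0, ∞) × (E × E)`, then for `t, t' ≥ 0`,
`∫_{t}^{t'} ψ σ (x₀ + σ v, v) dσ = F t' (x₀ + t' v, v) - F t (x₀ + t v, v)`. [folklore] -/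
theorem integral_characteristic_eq_sub {F : ℝ → E × E → G} {ψ : ℝ → E × E → G}
    (hψ : ∀ (x₀ v : E), ∀ s ≥ (0 : ℝ),
      HasDerivWithinAt (fun σ => F σ (x₀ + σ • v, v)) (ψ s (x₀ + s • v, v)) (Ici 0) s)
    (hψc : ContinuousOn (fun p : ℝ × (E × E) => ψ p.1 p.2) (Ici 0 ×ˢ univ))
    (x₀ v : E) {t t' : ℝ} (ht : 0 ≤ t) (ht' : 0 ≤ t') :
    ∫ σ in t..t', ψ σ (x₀ + σ • v, v) = F t' (x₀ + t' • v, v) - F t (x₀ + t • v, v) := by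
  -- continuity of the integrand on `[0, ∞)` and of `F` along the characteristic
  have hγ : Continuous fun σ : ℝ => ((σ, (x₀ + σ • v, v)) : ℝ × (E × E)) :=
    continuous_id.prodMk ((continuous_const.add (continuous_id.smul continuous_const)).prodMk
      continuous_const)
  have hψcont : ContinuousOn (fun σ : ℝ => ψ σ (x₀ + σ • v, v)) (Ici 0) :=
    hψc.comp hγ.continuousOn fun σ hσ => ⟨hσ, mem_univ _⟩
  have hFcont : ContinuousOn (fun σ : ℝ => F σ (x₀ + σ • v, v)) (Ici 0) := fun s hs =>
    (hψ x₀ v s hs).continuousWithinAt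
  -- the ordered case
  have key : ∀ {a b : ℝ}, 0 ≤ a → a ≤ b →
      ∫ σ in a..b, ψ σ (x₀ + σ • v, v) = F b (x₀ + b • v, v) - F a (x₀ + a • v, v) := by
    intro a b ha hab
    have hsub : Icc a b ⊆ Ici 0 := fun σ hσ => ha.trans hσ.1
    refine integral_eq_sub_of_hasDeriv_right_of_le hab (hFcont.mono hsub) (fun σ hσ => ?_) ?_
    · have hσ0 : 0 < σ := ha.trans_lt hσ.1
      exact ((hψ x₀ v σ hσ0.le).hasDerivAt (Ici_mem_nhds hσ0)).hasDerivWithinAt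
    · refine (hψcont.mono ?_).intervalIntegrable
      rw [uIcc_of_le hab]
      exact hsub
  rcases le_total t t' with h | h
  · exact key ht h
  · rw [integral_symm, key ht' h, neg_sub]

/-- **Fréchet differentiability within the closed half-space from the kinetic structure.** Under
slice differentiability with jointly continuous slice derivative `D`, and right differentiability
along the free-transport characteristics with jointly continuous derivative `ψ`, the function
`(t, z) ↦ F t z` has, within `[0, ∞) × (E × E)` at `(t, z)`, `z = (x, v)`, the Fréchet derivative
`(τ, h) ↦ τ (ψ t z - D t z (v, 0)) + D t z h`. [folklore] -/
theorem hasFDerivWithinAt_kinetic {F : ℝ → E × E → G} {D : ℝ → E × E → (E × E →L[ℝ] G)}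
    {ψ : ℝ → E × E → G} (hD : ∀ t ≥ (0 : ℝ), ∀ z, HasFDerivAt (F t) (D t z) z)
    (hψ : ∀ (x₀ v : E), ∀ s ≥ (0 : ℝ),
      HasDerivWithinAt (fun σ => F σ (x₀ + σ • v, v)) (ψ s (x₀ + s • v, v)) (Ici 0) s)
    (hψc : ContinuousOn (fun p : ℝ × (E × E) => ψ p.1 p.2) (Ici 0 ×ˢ univ))
    {t : ℝ} (ht : 0 ≤ t) (z : E × E) :
    HasFDerivWithinAt (fun p : ℝ × (E × E) => F p.1 p.2)
      ((ContinuousLinearMap.fst ℝ ℝ (E × E)).smulRight (ψ t z - D t z (z.2, 0)) +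
        (D t z).comp (ContinuousLinearMap.snd ℝ ℝ (E × E))) (Ici 0 ×ˢ univ) (t, z) := by
  rw [hasFDerivWithinAt_iff_isLittleO, Asymptotics.isLittleO_iff]
  intro c hc
  set K₁ : ℝ := 2 + ‖z.2‖ with hK₁
  have hK₁1 : 1 ≤ K₁ := by rw [hK₁]; linarith [norm_nonneg z.2]
  have hK₁0 : 0 < K₁ := one_pos.trans_le hK₁1
  -- slice differentiability at `z`, tolerance `c / (4 K₁)`
  have hc₁ : 0 < c / (4 * K₁) := by positivity
  obtain ⟨δ₁, hδ₁, hslice⟩ : ∃ δ₁ > 0, ∀ y : E × E, dist y z < δ₁ →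
      ‖F t y - F t z - D t z (y - z)‖ ≤ c / (4 * K₁) * ‖y - z‖ :=
    Metric.eventually_nhds_iff.1 (Asymptotics.isLittleO_iff.1 (hD t ht z).isLittleO hc₁)
  -- joint continuity of `ψ` at `(t, z)` within the half-space, tolerance `c / 4`
  obtain ⟨δ₂, hδ₂, hcont⟩ := Metric.continuousWithinAt_iff.1 (hψc (t, z) ⟨ht, mem_univ _⟩)
    (c / 4) (by positivity)
  -- the radius
  set δ : ℝ := min (min 1 (δ₁ / K₁)) (min (δ₂ / K₁) (c / (2 * (‖D t z‖ + 1)))) with hδ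
  have hδ0 : 0 < δ := lt_min (lt_min one_pos (by positivity)) (lt_min (by positivity) (by positivity))
  rw [eventually_nhdsWithin_iff, Metric.eventually_nhds_iff]
  refine ⟨δ, hδ0, ?_⟩
  rintro ⟨t', z'⟩ hdist ⟨ht', -⟩
  simp only [mem_Ici] at ht'
  -- notation
  set ρ : ℝ := ‖((t', z') : ℝ × (E × E)) - (t, z)‖ with hρ
  have hρdist : ρ < δ := by rwa [dist_eq_norm] at hdist
  have hρ1 : ρ ≤ 1 := (hρdist.trans_le ((min_le_left _ _).trans (min_le_left _ _))).le
  have hρδ₁ : ρ * K₁ < δ₁ := by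
    have := hρdist.trans_le ((min_le_left _ _).trans (min_le_right _ _))
    rwa [lt_div_iff₀ hK₁0] at this
  have hρδ₂ : ρ * K₁ < δ₂ := by
    have := hρdist.trans_le ((min_le_right _ _).trans (min_le_left _ _))
    rwa [lt_div_iff₀ hK₁0] at this
  have hρD : ρ * (‖D t z‖ + 1) < c / 2 := by
    have := hρdist.trans_le ((min_le_right _ _).trans (min_le_right _ _))
    rw [lt_div_iff₀ (by positivity)] at this
    linarith
  set τ : ℝ := t' - t with hτ
  set x := z.1
  set v := z.2
  set x' := z'.1
  set v' := z'.2
  have hτρ : |τ| ≤ ρ := by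
    have := norm_fst_le (((t', z') : ℝ × (E × E)) - (t, z))
    rwa [Prod.fst_sub, Real.norm_eq_abs] at this
  have hhρ : ‖z' - z‖ ≤ ρ := norm_snd_le (((t', z') : ℝ × (E × E)) - (t, z))
  have hxρ : ‖x' - x‖ ≤ ρ := (norm_fst_le (z' - z)).trans hhρ
  have hvρ : ‖v' - v‖ ≤ ρ := (norm_snd_le (z' - z)).trans hhρ
  have hρ0 : 0 ≤ ρ := norm_nonneg _
  have hv' : ‖v'‖ ≤ ‖v‖ + ρ := by
    calc ‖v'‖ = ‖v + (v' - v)‖ := by rw [add_sub_cancel]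
      _ ≤ ‖v‖ + ‖v' - v‖ := norm_add_le _ _
      _ ≤ ‖v‖ + ρ := add_le_add le_rfl hvρ
  have hτv' : |τ| * ‖v'‖ ≤ ρ * (‖v‖ + 1) :=
    mul_le_mul hτρ (hv'.trans (by linarith)) (norm_nonneg _) hρ0
  -- the foot `x₀` of the characteristic through `(t', z')`, and its position `y` at time `t`
  set x₀ : E := x' - t' • v' with hx₀
  set y : E := x₀ + t • v' with hy
  have hyt' : x₀ + t' • v' = x' := by rw [hx₀]; abel
  have hyx : y - x = (x' - x) - τ • v' := by rw [hy, hx₀, hτ, sub_smul]; abel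
  set k : E × E := ((y, v') : E × E) - z with hk
  have hk1 : k.1 = (x' - x) - τ • v' := by rw [hk, Prod.fst_sub]; exact hyx
  have hk2 : k.2 = v' - v := by rw [hk, Prod.snd_sub]
  have hknorm : ‖k‖ ≤ ρ * K₁ := by
    rw [Prod.norm_def, hk1, hk2]
    refine max_le ?_ (hvρ.trans ?_)
    · calc ‖x' - x - τ • v'‖ ≤ ‖x' - x‖ + ‖τ • v'‖ := norm_sub_le _ _
        _ = ‖x' - x‖ + |τ| * ‖v'‖ := by rw [norm_smul, Real.norm_eq_abs]
        _ ≤ ρ + ρ * (‖v‖ + 1) := add_le_add hxρ hτv'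
        _ = ρ * K₁ := by rw [hK₁]; ring
    · nlinarith
  -- (1) the characteristic part
  have hchar : F t' (x', v') - F t (y, v') = ∫ σ in t..t', ψ σ (x₀ + σ • v', v') := by
    rw [integral_characteristic_eq_sub hψ hψc x₀ v' ht ht', hyt']
  have hA : ‖(F t' (x', v') - F t (y, v')) - τ • ψ t z‖ ≤ c / 4 * |τ| := by
    rw [hchar]
    have hconst : ∫ _ in t..t', ψ t z = τ • ψ t z := by rw [integral_const, hτ]
    rw [← hconst, ← integral_sub, hτ]
    · refine norm_integral_le_of_norm_le_const fun σ hσmem => ?_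
      -- `σ` lies between `t` and `t'`
      have hσI : min t t' < σ ∧ σ ≤ max t t' := by simpa only [uIoc, mem_Ioc] using hσmem
      have hσ0 : 0 ≤ σ := (le_min ht ht').trans hσI.1.le
      have hστ : |σ - t| ≤ |τ| ∧ |σ - t'| ≤ |τ| := by
        rcases le_total t t' with h | h
        · rw [min_eq_left h, max_eq_right h] at hσI
          rw [hτ, abs_of_nonneg (sub_nonneg.2 h)]
          exact ⟨abs_le.2 ⟨by linarith, by linarith⟩, abs_le.2 ⟨by linarith, by linarith⟩⟩
        · rw [min_eq_right h, max_eq_left h] at hσI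
          rw [hτ, abs_of_nonpos (sub_nonpos.2 h)]
          exact ⟨abs_le.2 ⟨by linarith, by linarith⟩, abs_le.2 ⟨by linarith, by linarith⟩⟩
      have hpos : ‖x₀ + σ • v' - x‖ ≤ ρ * K₁ := by
        have e : x₀ + σ • v' - x = (x' - x) + (σ - t') • v' := by rw [hx₀, sub_smul]; abel
        rw [e]
        calc ‖x' - x + (σ - t') • v'‖ ≤ ‖x' - x‖ + ‖(σ - t') • v'‖ := norm_add_le _ _
          _ = ‖x' - x‖ + |σ - t'| * ‖v'‖ := by rw [norm_smul, Real.norm_eq_abs]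
          _ ≤ ρ + |τ| * ‖v'‖ :=
              add_le_add hxρ (mul_le_mul_of_nonneg_right hστ.2 (norm_nonneg _))
          _ ≤ ρ + ρ * (‖v‖ + 1) := add_le_add le_rfl hτv'
          _ = ρ * K₁ := by rw [hK₁]; ring
      have hd : dist ((σ, (x₀ + σ • v', v')) : ℝ × (E × E)) (t, z) < δ₂ := by
        rw [dist_eq_norm, Prod.norm_def, Prod.norm_def]
        refine max_lt ?_ (max_lt ?_ ?_)
        · rw [Real.norm_eq_abs]
          exact (hστ.1.trans hτρ).trans_lt ((le_mul_of_one_le_right hρ0 hK₁1).trans_lt hρδ₂)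
        · exact hpos.trans_lt hρδ₂
        · exact (hvρ.trans (le_mul_of_one_le_right hρ0 hK₁1)).trans_lt hρδ₂
      have := hcont (x := (σ, (x₀ + σ • v', v'))) (mk_mem_prod (mem_Ici.2 hσ0) (mem_univ _)) hd
      rw [dist_eq_norm] at this
      exact this.le
    · have hsub : uIcc t t' ⊆ Ici 0 := fun σ hσ => by
        rcases le_total t t' with h | h
        · rw [uIcc_of_le h] at hσ; exact ht.trans hσ.1
        · rw [uIcc_of_ge h] at hσ; exact ht'.trans hσ.1
      have hco : ContinuousOn (fun σ : ℝ => ψ σ (x₀ + σ • v', v')) (Ici 0) :=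
        hψc.comp (continuous_id.prodMk ((continuous_const.add (continuous_id.smul
          continuous_const)).prodMk continuous_const)).continuousOn
          fun σ (hσ : σ ∈ Ici (0:ℝ)) => mk_mem_prod hσ (mem_univ _)
      exact (hco.mono hsub).intervalIntegrable
    · exact intervalIntegrable_const
  -- (2) the slice part
  have hB : ‖F t (y, v') - F t z - D t z k‖ ≤ c / (4 * K₁) * ‖k‖ := by
    have hyz : ((y, v') : E × E) = z + k := by rw [hk]; abel
    have hd : dist ((y, v') : E × E) z < δ₁ := by
      rw [dist_eq_norm, show ((y, v') : E × E) - z = k from rfl]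
      exact hknorm.trans_lt hρδ₁
    have := hslice (y, v') hd
    rwa [show ((y, v') : E × E) - z = k from rfl] at this
  -- (3) assemble
  have hDk : D t z k = D t z (z' - z) - τ • D t z (v, 0) - τ • D t z (v' - v, 0) := by
    have e : k = (z' - z) - τ • ((v, (0 : E)) : E × E) - τ • ((v' - v, (0 : E)) : E × E) := by
      ext
      · rw [hk1]
        simp only [Prod.fst_sub, Prod.smul_fst, smul_sub]
        abel
      · rw [hk2]
        simp only [Prod.snd_sub, Prod.smul_snd, smul_zero, sub_zero]
        rfl
    rw [e, map_sub, map_sub, map_smul, map_smul]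
  have hR : F t' z' - F t z - ((ContinuousLinearMap.fst ℝ ℝ (E × E)).smulRight (ψ t z - D t z (z.2, 0)) +
      (D t z).comp (ContinuousLinearMap.snd ℝ ℝ (E × E))) ((t', z') - (t, z)) =
      ((F t' (x', v') - F t (y, v')) - τ • ψ t z) + (F t (y, v') - F t z - D t z k) -
        τ • D t z (v' - v, 0) := by
    have e1 : F t' z' = F t' (x', v') := rfl
    simp only [add_apply, ContinuousLinearMap.smulRight_apply,
      ContinuousLinearMap.coe_fst', ContinuousLinearMap.coe_comp, comp_apply,
      ContinuousLinearMap.coe_snd', Prod.fst_sub, Prod.snd_sub, hDk, e1, smul_sub]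
    rw [← hτ]
    abel
  rw [hR]
  calc ‖((F t' (x', v') - F t (y, v')) - τ • ψ t z) + (F t (y, v') - F t z - D t z k) -
        τ • D t z (v' - v, 0)‖
      ≤ ‖(F t' (x', v') - F t (y, v')) - τ • ψ t z‖ + ‖F t (y, v') - F t z - D t z k‖ +
          ‖τ • D t z (v' - v, 0)‖ := norm_sub_le_of_le (norm_add_le _ _) le_rfl
    _ ≤ c / 4 * |τ| + c / (4 * K₁) * ‖k‖ + |τ| * (‖D t z‖ * ‖v' - v‖) := by
        refine add_le_add (add_le_add hA hB) ?_
        have hn0 : ‖((v' - v, (0 : E)) : E × E)‖ = ‖v' - v‖ := by simp [Prod.norm_def]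
        rw [norm_smul, Real.norm_eq_abs, ← hn0]
        exact mul_le_mul_of_nonneg_left (ContinuousLinearMap.le_opNorm _ _) (abs_nonneg _)
    _ ≤ c / 4 * ρ + c / (4 * K₁) * (ρ * K₁) + ρ * (‖D t z‖ * ρ) := by
        gcongr
    _ = ρ * (c / 4 + c / 4 + ρ * ‖D t z‖) := by field_simp
    _ ≤ ρ * c := by
        refine mul_le_mul_of_nonneg_left ?_ hρ0
        nlinarith [norm_nonneg (D t z)]
    _ = c * ρ := mul_comm _ _

omit [CompleteSpace G] in
/-- The candidate derivative field is continuous on the half-space when `D` and `ψ` are. [folklore] -/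
theorem continuousOn_kineticFDeriv {D : ℝ → E × E → (E × E →L[ℝ] G)} {ψ : ℝ → E × E → G}
    (hDc : ContinuousOn (fun p : ℝ × (E × E) => D p.1 p.2) (Ici 0 ×ˢ univ))
    (hψc : ContinuousOn (fun p : ℝ × (E × E) => ψ p.1 p.2) (Ici 0 ×ˢ univ)) :
    ContinuousOn (fun p : ℝ × (E × E) =>
      (ContinuousLinearMap.fst ℝ ℝ (E × E)).smulRight (ψ p.1 p.2 - D p.1 p.2 (p.2.2, 0)) +
        (D p.1 p.2).comp (ContinuousLinearMap.snd ℝ ℝ (E × E))) (Ici 0 ×ˢ univ) := by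
  have hV : Continuous fun p : ℝ × (E × E) => ((p.2.2, (0 : E)) : E × E) :=
    (continuous_snd.comp continuous_snd).prodMk continuous_const
  have h1 : ContinuousOn (fun p : ℝ × (E × E) => ψ p.1 p.2 - D p.1 p.2 (p.2.2, 0)) (Ici 0 ×ˢ univ) :=
    hψc.sub (hDc.clm_apply hV.continuousOn)
  have h2 : ContinuousOn (fun p : ℝ × (E × E) =>
      (ContinuousLinearMap.fst ℝ ℝ (E × E)).smulRight (ψ p.1 p.2 - D p.1 p.2 (p.2.2, 0)))
      (Ici 0 ×ˢ univ) :=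
    (ContinuousLinearMap.smulRightL ℝ (ℝ × (E × E)) G (ContinuousLinearMap.fst ℝ ℝ (E × E))).continuous
      |>.comp_continuousOn h1
  exact h2.add (hDc.clm_comp continuousOn_const)

/-- **Joint `C¹` regularity on the closed half-space from the kinetic structure.** Under the
hypotheses of `hasFDerivWithinAt_kinetic` with `D` jointly continuous as well,
`(t, z) ↦ F t z` is `C¹` on `[0, ∞) × (E × E)` (`ContDiffOn`). [folklore] -/
theorem contDiffOn_one_kinetic {F : ℝ → E × E → G} {D : ℝ → E × E → (E × E →L[ℝ] G)}
    {ψ : ℝ → E × E → G} (hD : ∀ t ≥ (0 : ℝ), ∀ z, HasFDerivAt (F t) (D t z) z)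
    (hDc : ContinuousOn (fun p : ℝ × (E × E) => D p.1 p.2) (Ici 0 ×ˢ univ))
    (hψ : ∀ (x₀ v : E), ∀ s ≥ (0 : ℝ),
      HasDerivWithinAt (fun σ => F σ (x₀ + σ • v, v)) (ψ s (x₀ + s • v, v)) (Ici 0) s)
    (hψc : ContinuousOn (fun p : ℝ × (E × E) => ψ p.1 p.2) (Ici 0 ×ˢ univ)) :
    ContDiffOn ℝ 1 (fun p : ℝ × (E × E) => F p.1 p.2) (Ici 0 ×ˢ univ) := by
  have h := contDiffOn_succ_iff_hasFDerivWithinAt (𝕜 := ℝ) (n := 0)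
    (f := fun p : ℝ × (E × E) => F p.1 p.2) (s := Ici (0 : ℝ) ×ˢ (univ : Set (E × E))) (by simp)
  rw [zero_add] at h
  refine h.2 fun p hp => ⟨Ici 0 ×ˢ univ, ?_, fun h0 => ?_, _, fun q hq =>
    hasFDerivWithinAt_kinetic hD hψ hψc hq.1 q.2, ?_⟩
  · rw [insert_eq_of_mem hp]
    exact self_mem_nhdsWithin
  · exact absurd h0 (by simp)
  · exact contDiffOn_zero.2 (continuousOn_kineticFDeriv hDc hψc)

/-- **The one-sided time derivative.** Under the hypotheses of `hasFDerivWithinAt_kinetic`,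
`∂ₜF(t, z)` within `[0, ∞)` is `ψ t z - D t z (v, 0)`. [folklore] -/
theorem derivWithin_kinetic {F : ℝ → E × E → G} {D : ℝ → E × E → (E × E →L[ℝ] G)}
    {ψ : ℝ → E × E → G} (hD : ∀ t ≥ (0 : ℝ), ∀ z, HasFDerivAt (F t) (D t z) z)
    (hψ : ∀ (x₀ v : E), ∀ s ≥ (0 : ℝ),
      HasDerivWithinAt (fun σ => F σ (x₀ + σ • v, v)) (ψ s (x₀ + s • v, v)) (Ici 0) s)
    (hψc : ContinuousOn (fun p : ℝ × (E × E) => ψ p.1 p.2) (Ici 0 ×ˢ univ))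
    {t : ℝ} (ht : 0 ≤ t) (z : E × E) :
    derivWithin (fun s => F s z) (Ici 0) t = ψ t z - D t z (z.2, 0) := by
  have hF := hasFDerivWithinAt_kinetic hD hψ hψc ht z
  have hc : HasDerivWithinAt (fun s : ℝ => ((s, z) : ℝ × (E × E))) ((1 : ℝ), (0 : E × E)) (Ici 0) t :=
    (hasDerivWithinAt_id t _).prodMk (hasDerivWithinAt_const t _ z)
  have hcomp := hF.comp_hasDerivWithinAt t hc fun s hs => mk_mem_prod hs (mem_univ _)
  have heq : ((fun p : ℝ × (E × E) => F p.1 p.2) ∘ fun s : ℝ => ((s, z) : ℝ × (E × E))) =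
      fun s => F s z := rfl
  rw [heq] at hcomp
  rw [hcomp.derivWithin (uniqueDiffOn_Ici (0 : ℝ) t ht)]
  simp

/-- **The transport equation in the target form**: `∂ₜF(t, x, v)` (within `[0, ∞)`) plus
`D_x F(t, ·, v)(x) v` equals `ψ t (x, v)`. [folklore] -/
theorem derivWithin_add_fderiv_kinetic {F : ℝ → E × E → G} {D : ℝ → E × E → (E × E →L[ℝ] G)}
    {ψ : ℝ → E × E → G} (hD : ∀ t ≥ (0 : ℝ), ∀ z, HasFDerivAt (F t) (D t z) z)
    (hψ : ∀ (x₀ v : E), ∀ s ≥ (0 : ℝ),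
      HasDerivWithinAt (fun σ => F σ (x₀ + σ • v, v)) (ψ s (x₀ + s • v, v)) (Ici 0) s)
    (hψc : ContinuousOn (fun p : ℝ × (E × E) => ψ p.1 p.2) (Ici 0 ×ˢ univ))
    {t : ℝ} (ht : 0 ≤ t) (x v : E) :
    derivWithin (fun s => F s (x, v)) (Ici 0) t + fderiv ℝ (fun y => F t (y, v)) x v = ψ t (x, v) := by
  rw [derivWithin_kinetic hD hψ hψc ht (x, v)]
  have hslice : HasFDerivAt (fun y : E => F t (y, v)) ((D t (x, v)).comp (ContinuousLinearMap.inl ℝ E E)) x := by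
    have h1 : HasFDerivAt (fun y : E => ((y, v) : E × E)) (ContinuousLinearMap.inl ℝ E E) x :=
      (hasFDerivAt_id x).prodMk (hasFDerivAt_const v x)
    exact (hD t ht (x, v)).comp x h1
  rw [hslice.fderiv]
  simp

end Literature.Analysis.Calculus

end
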